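import Literature.Barriers.QuantumFields.DiscreteSubgroupFreezingNoScaling
import Summits.QuantumFields.YangMills.Theorems.NotChatterjeeMassGapProblem
import HarnessLib

/-!
# LINE L2, torus twin (ym-idea-4 g5): `LatticeMassGapAllCouplings` (strong-hypothesis registry row 5,
A9 torus vocabulary) is refutable AS TYPED modulo ONE named input — torus clustering for a finite
non-abelian gauge group

Row 6 (`ChatterjeeMassGapProblem`, Sweep1 free-boundary vocabulary) is refuted in the tree from the
named fact `AdhikariCao2022.correlationDecay` (`not_chatterjeeMassGapProblem`).  Its torus twin, row 5
(`LatticeMassGapAllCouplings`, limit points of TORUS Wilson states), has the same over-broad `∀`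
(all compact non-abelian `G ⊂ U(N)`, hence all FINITE ones), but Adhikari–Cao's Theorem 1.1 is a
FREE-boundary statement and the tree's torus clustering theorem `abelianHiggs_torus_clustering` is
ABELIAN (`CommGroup`).  This file isolates the exact missing input: torus clustering of the
plaquette two-point function at SOME rate `m > 0` beyond SOME coupling, for ONE finite non-abelian
model — and proves the port from it (the argument of the PROVED `ℤ_n` barrier
`zn_not_divergentCorrLength`, made generic in the gauge group).  Everything here is fully proved;
no new definitions.  Statement hygiene, nothing about `SU(N)`; no summit is proved.
-/

noncomputable section

open MeasureTheory Filter Topology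
open Literature.MathematicalPhysics.QuantumLattice Literature.MathematicalPhysics.QuantumFieldTheory
open Literature.MathematicalPhysics.QuantumFieldTheory.AdhikariCao2022 (deltaG)
open Literature.Probability.LatticeModels (HasExponentialDecayRate HasInvCorrLength)
open Literature.Barriers.QuantumFields (le_of_hasInvCorrLength_of_decay norm_natCast_zsmul_single)

namespace Summit.QuantumFields.YangMills.Theorems.NotChatterjeeMassGap

/-- **A torus decay rate bounds every Problem-5.1 correlation length:** if the plaquette–plaquette
correlation `f = plaquetteCorrFn ρ μ` of a state `μ` decays at rate `m` (`|f x| ≤ C e^{-m‖x‖_∞}`),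
is eventually positive, and has inverse correlation length `ξ⁻¹` along the axis, then `ξ ≤ 1/m`
(generic form of `zn_corrLength_le_one`; `0 < ξ` is then automatic). [cite: arXiv180301950, §5 Problem 5.1] -/
theorem corrLength_le_inv_of_decay {G : Type} [Group G] [MeasurableSpace G] {N : ℕ}
    (ρ : G →* Matrix (Fin N) (Fin N) ℂ) {μ : Measure (LGConfig 4 G)} {m ξ : ℝ}
    (hdec : HasExponentialDecayRate (plaquetteCorrFn ρ μ) m)
    (hpos : ∀ᶠ x in cofinite, 0 < plaquetteCorrFn ρ μ x)
    (hlim : HasInvCorrLength (plaquetteCorrFn ρ μ) ξ⁻¹) : ξ ≤ m⁻¹ := by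
  have hm : 0 < m := hdec.1
  have hinj : Function.Injective fun k : ℕ => ((k : ℤ) • Pi.single (0 : Fin 4) (1 : ℤ) :
      Literature.Probability.LatticeModels.Site 4) := by
    intro a b hab
    have := congrArg (fun x : Literature.Probability.LatticeModels.Site 4 => ‖x‖) hab
    simp only [norm_natCast_zsmul_single] at this
    exact_mod_cast this
  have hax : Tendsto (fun k : ℕ => ((k : ℤ) • Pi.single (0 : Fin 4) (1 : ℤ) :
      Literature.Probability.LatticeModels.Site 4)) atTop cofinite := by
    rw [← Nat.cofinite_eq_atTop]
    exact hinj.tendsto_cofinite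
  have hne : ∀ᶠ k : ℕ in atTop,
      plaquetteCorrFn ρ μ ((k : ℤ) • Pi.single (0 : Fin 4) (1 : ℤ)) ≠ 0 :=
    (hax.eventually hpos).mono fun k hk => hk.ne'
  have h1 : m ≤ ξ⁻¹ := le_of_hasInvCorrLength_of_decay hdec hne hlim
  have h2 := inv_anti₀ hm h1
  rwa [inv_inv] at h2

/-- **The port, generic in the gauge group: torus clustering for ONE admissible model refutes
`LatticeMassGapAllCouplings` as typed.**  If some compact (second countable) `G` with a faithful
continuous unitary `ρ : G → U(N)`, `N ≥ 2`, and a non-commuting pair — i.e. a model INSIDE the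
typed `∀` of row 5 — has its torus limit states clustering at a `β`-UNIFORM rate `m > 0` beyond some
coupling `β_f` (for a FINITE `G` the printed rate even grows like `βΔ_G/2`: Adhikari–Cao, free
b.c.), then the scaling clause `ξ(β) → ∞` fails for that model, so the registered statement is
false.  For `G = ℤ_n` the hypothesis is the tree theorem `zn_plaquetteCorrFn_decay` (rate `1`),
but `ℤ_n` is abelian and lies outside row 5's `∀`; for a finite NON-abelian `G` (e.g. `S₃ ⊂ U(3)`,
`exists_finite_nonabelian_model`) it is Adhikari–Cao's theorem transported to periodic boundary
conditions — NOT in the tree (`abelianHiggs_torus_clustering` needs `CommGroup`) and not stated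
in print for the torus: the one missing input. [cite: arXiv180301950, §5 Problem 5.1]
[cite: AdhikariCao2025, Thm. 1.1] [cite: MontvayMunster1994, §3.7.1 item 3 (PDF p. 164)] -/
theorem not_latticeMassGapAllCouplings_of_torusDecay {G : Type} [Group G] [TopologicalSpace G]
    [IsTopologicalGroup G] [CompactSpace G] [T2Space G] [SecondCountableTopology G]
    [MeasurableSpace G] [BorelSpace G] {N : ℕ} (ρ : G →* Matrix (Fin N) (Fin N) ℂ) (hN : 2 ≤ N)
    (hρc : Continuous ρ) (hinj : Function.Injective ρ)
    (hunit : ∀ g : G, ρ g ∈ Matrix.unitaryGroup (Fin N) ℂ) (hnc : ∃ g h : G, g * h ≠ h * g)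
    (hT : ∃ β_f m : ℝ, 0 < m ∧ ∀ β : ℝ, β_f < β →
      ∀ μ ∈ infiniteVolumeLimitPoints (d := 4) ρ β, HasExponentialDecayRate (plaquetteCorrFn ρ μ) m) :
    ¬ LatticeMassGapAllCouplings := by
  intro h
  obtain ⟨ξ, hξ, hdiv⟩ := h N G ρ hN hρc hinj hunit hnc
  obtain ⟨β_f, m, hm, hT⟩ := hT
  obtain ⟨β₂, hβ₂⟩ := (hdiv (m⁻¹ + 1)).exists_forall_of_atTop
  set β : ℝ := max (max β_f β₂) 0 + 1 with hβ
  have hb0 : 0 < β := by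
    have := le_max_right (max β_f β₂) (0 : ℝ); linarith
  have hbf : β_f < β := by
    have := le_max_left (max β_f β₂) (0 : ℝ); have := le_max_left β_f β₂; linarith
  have hb2 : β₂ ≤ β := by
    have := le_max_left (max β_f β₂) (0 : ℝ); have := le_max_right β_f β₂; linarith
  obtain ⟨μ, hμ⟩ := infiniteVolumeLimitPoints_nonempty_holds (d := 4) ρ hρc β
  obtain ⟨-, hev, -, hlim⟩ := hξ β hb0 μ hμ
  have h1 : ξ β μ ≤ m⁻¹ := corrLength_le_inv_of_decay ρ (hT β hbf μ hμ) hev hlim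
  have h2 : m⁻¹ + 1 ≤ ξ β μ := hβ₂ β hb2 μ hμ
  linarith

/-- **Row 5 modulo "Adhikari–Cao on the torus".**  If every FINITE gauge group with a unitary
representation of positive gap `Δ_G` has torus limit states whose plaquette two-point function
decays at some `β`-uniform rate beyond some coupling (the periodic-boundary form of Adhikari–Cao's
Theorem 1.1, whose free-boundary form is the tree fact `AdhikariCao2022.correlationDecay`; for
finite ABELIAN groups it is the tree theorem `abelianHiggs_torus_clustering`), then
`LatticeMassGapAllCouplings` is false as typed: the finite non-abelian witness `S₃ ⊂ U(3)`
(`exists_finite_nonabelian_model`, `Δ_{S₃} = 2`) freezes.  Mirror of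
`not_chatterjeeMassGapProblem` (row 6, proved outright). [cite: AdhikariCao2025, Thm. 1.1]
[cite: arXiv180301950, §5 Problem 5.1] -/
theorem not_latticeMassGapAllCouplings_of_finiteTorusDecay
    (hT : ∀ (G : Type) [Group G] [Fintype G] [TopologicalSpace G] [DiscreteTopology G]
      [IsTopologicalGroup G] [CompactSpace G] [MeasurableSpace G] [BorelSpace G] (N : ℕ)
      (ρ : G →* Matrix (Fin N) (Fin N) ℂ), (∀ g : G, ρ g ∈ Matrix.unitaryGroup (Fin N) ℂ) →
      0 < deltaG ρ → ∃ β_f m : ℝ, 0 < m ∧ ∀ β : ℝ, β_f < β →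
        ∀ μ ∈ infiniteVolumeLimitPoints (d := 4) ρ β,
          HasExponentialDecayRate (plaquetteCorrFn ρ μ) m) :
    ¬ LatticeMassGapAllCouplings := by
  obtain ⟨G, _, _, _, _, _, _, _, _, N, ρ, hN, hρc, hinj, hunit, hnc, hΔ⟩ :=
    exists_finite_nonabelian_model
  haveI : T2Space G := inferInstance
  haveI : SecondCountableTopology G := inferInstance
  exact not_latticeMassGapAllCouplings_of_torusDecay ρ hN hρc hinj hunit hnc (hT G N ρ hunit hΔ)

end Summit.QuantumFields.YangMills.Theorems.NotChatterjeeMassGap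

end
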